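import Summits.QuantumFields.QCD.Theses.HeatSlicedQuarks
import Summits.QuantumFields.QCD.Theorems.SmallFieldUltracontractivity.Negative.LoadBearing

/-!
# Negative knowledge for crux `TracedQuadraticParametrix` (stmt-QuantumFields-17985):
# the hypothesis `r ≤ L` is load-bearing

Certified copy of §1 of the cdisprove work file
`Summits/QuantumFields/QCD/Cruxes/TracedQuadraticParametrix/Disproof.lean` (refuter, cdisprove seat,
cycle 1).  Supports stmt-QuantumFields-17985; asserts no route item.

* `crux_iff` — the crux re-displayed through local abbreviations (`trDiag`, `SmallPlaq`, `rhs`,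
  `freeCfg`), by `Iff.rfl`; it certifies that the variant below differs from the crux ONLY by the
  dropped hypothesis.
* `TracedQuadraticParametrixWithoutRLeL` — the crux with `r ≤ L` deleted (so `t ≤ r²` no longer
  implies `t ≤ L²`).
* `tracedQuadraticParametrix_false_without_rLeL : ¬ TracedQuadraticParametrixWithoutRLeL` — witness:
  the one-site torus `L = 1`, the flat "toron" `U(·,0) = diag(−1,−1,1) ∈ SU(3)`, other links `1`
  (every plaquette holonomy is `1`, so the global smallness hypothesis holds for EVERY `r`), `m = 0`,
  `t = r² → ∞`.  There `D_W(1) = 0` and `D_W(U) = diag(2,2,0)_colour ⊗ 1_spin` exactly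
  (landed `wilsonDirac_freeCfg_one_zero`, and `wilsonDirac_toron` here), so the traced kernels are `12` and `8e^{−4t} + 4`
  (`trDiag_free_one`, `trDiag_toron`): the left side is `8 − 8e^{−4r²} ≥ 4` while the right side is
  `≤ |C|(ε² + 1)/r → 0`.

Reading for provers: any proof must use `t ≤ L²` (through `t ≤ r²`, `r ≤ L`) — for `t ≫ L²` the free
kernel is carried by its zero mode `12/L⁴` while a flat connection with non-trivial holonomy is
gapped, and ONLY the log-corrected tail `C e^{−cL²/(t(1+log t)²)}/t² → C/t²` at `t ≍ L²` pays for
this inside the crux.  (The companion numerics and the analysis of why the crux itself resists are in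
the work file's docblock.)
-/

noncomputable section

namespace Summit.QuantumFields.QCD.Theorems.TracedQuadraticParametrix.Negative

open Literature.MathematicalPhysics.QuantumLattice Literature.MathematicalPhysics.QuantumFieldTheory
  Literature.Probability.LatticeModels
open Summit.QuantumFields.QCD.Theses.HeatSlicedQuarks
open scoped Matrix ComplexConjugate BigOperators

/-- `SU(3)` for short. -/
abbrev SU3 := Matrix.specialUnitaryGroup (Fin 3) ℂ

/-- The free configuration `U ≡ 1`, written exactly as in the crux. -/
abbrev freeCfg (L : ℕ) : GaugeConfig 4 L SU3 := fun _ : Edge 4 L => (1 : SU3)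

/-- The colour–spin traced on-diagonal heat kernel `Σ_{a,α} Re e^{-t D_Wᴴ D_W}((x,a,α),(x,a,α))`,
written exactly as in the crux (Wilson parameter `1`, fundamental `SU(3)`). -/
abbrev trDiag {L : ℕ} [NeZero L] (U : GaugeConfig 4 L SU3) (m t : ℝ) (x : TorusSite 4 L) : ℝ :=
  ∑ a : Fin 3, ∑ α : Fin 4, ((NormedSpace.exp (-(t : ℂ) •
    (Matrix.conjTranspose (wilsonDirac (fundamentalRep (Fin 3)) U m 1) *
      wilsonDirac (fundamentalRep (Fin 3)) U m 1))) (x, a, α) (x, a, α)).re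

/-- Global plaquette smallness `3 − Re tr U_p ≤ b` for every based plaquette, as in the crux. -/
abbrev SmallPlaq {L : ℕ} (U : GaugeConfig 4 L SU3) (b : ℝ) : Prop :=
  ∀ (y : TorusSite 4 L) (μ ν : Fin 4),
    3 - ((fundamentalRep (Fin 3)) (plaquetteHolonomy U y μ ν)).trace.re ≤ b

/-- The right-hand side `C (ε/r²)² + C e^{−cL²/(t(1+log t)²)}/t²` of the crux. -/
abbrev rhs (ε C c : ℝ) (L r : ℕ) (t : ℝ) : ℝ :=
  C * (ε / (r : ℝ) ^ 2) ^ 2 + C * Real.exp (-(c * (L : ℝ) ^ 2 / (t * (1 + Real.log t) ^ 2))) / t ^ 2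

/-- The crux, re-displayed through the abbreviations above (definitionally: `Iff.rfl`). -/
theorem crux_iff :
    TracedQuadraticParametrix ↔
      ∃ ε : ℝ, 0 < ε ∧ ∃ C c : ℝ, 0 < c ∧ ∀ (L : ℕ) [NeZero L] (U : GaugeConfig 4 L SU3) (m : ℝ),
        m ∈ Set.Icc (-(1 / 2 : ℝ)) 1 → ∀ (r : ℕ), 1 ≤ r → r ≤ L →
        SmallPlaq U ((ε / (r : ℝ) ^ 2) ^ 2) → ∀ (t : ℝ), 1 ≤ t → t ≤ (r : ℝ) ^ 2 →
        ∀ (x : TorusSite 4 L), |trDiag U m t x - trDiag (freeCfg L) m t x| ≤ rhs ε C c L r t :=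
  Iff.rfl

/-- **Variant (a1): the crux WITHOUT `r ≤ L`** (everything else verbatim).  Then `t ≤ r²` no longer
forces `t ≤ L²`, and flat connections with non-trivial holonomy (torons) break the bound at
`t = r² ≫ L²`: see `tracedQuadraticParametrix_false_without_rLeL`. -/
def TracedQuadraticParametrixWithoutRLeL : Prop :=
  ∃ ε : ℝ, 0 < ε ∧ ∃ C c : ℝ, 0 < c ∧ ∀ (L : ℕ) [NeZero L] (U : GaugeConfig 4 L SU3) (m : ℝ),
    m ∈ Set.Icc (-(1 / 2 : ℝ)) 1 → ∀ (r : ℕ), 1 ≤ r →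
    SmallPlaq U ((ε / (r : ℝ) ^ 2) ^ 2) → ∀ (t : ℝ), 1 ≤ t → t ≤ (r : ℝ) ^ 2 →
    ∀ (x : TorusSite 4 L), |trDiag U m t x - trDiag (freeCfg L) m t x| ≤ rhs ε C c L r t

/-! ### The `L = 1` toron witness -/

/-- `P = diag(−1, −1, 1) ∈ SU(3)`. -/
def Pmat : Matrix (Fin 3) (Fin 3) ℂ := Matrix.diagonal ![-1, -1, 1]

/-- `P² = 1`. -/
theorem Pmat_mul_Pmat : Pmat * Pmat = 1 := by
  ext i j
  fin_cases i <;> fin_cases j <;> simp [Pmat, Matrix.diagonal, Matrix.mul_apply]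

/-- `P` is self-adjoint (real diagonal). -/
theorem star_Pmat : star Pmat = Pmat := by
  ext i j
  fin_cases i <;> fin_cases j <;> simp [Pmat, Matrix.diagonal, Matrix.star_apply]

/-- `P` is special unitary. -/
theorem Pmat_mem : Pmat ∈ SU3 := by
  rw [Matrix.mem_specialUnitaryGroup_iff, Matrix.mem_unitaryGroup_iff, star_Pmat, Pmat_mul_Pmat]
  refine ⟨rfl, ?_⟩
  simp [Pmat, Matrix.det_diagonal, Fin.prod_univ_three]

/-- `P` as an element of `SU(3)`. -/
def Psu : SU3 := ⟨Pmat, Pmat_mem⟩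

/-- The fundamental representation of `P` is the matrix `P`. -/
@[simp] theorem fundamentalRep_Psu : fundamentalRep (Fin 3) Psu = Pmat := rfl

/-- The underlying matrix of `P` is `P`. -/
@[simp] theorem Psu_coe : (Psu : Matrix (Fin 3) (Fin 3) ℂ) = Pmat := rfl

/-- `P² = 1` in `SU(3)`. -/
theorem Psu_mul_Psu : Psu * Psu = 1 := Subtype.ext Pmat_mul_Pmat

/-- `P⁻¹ = P` in `SU(3)`. -/
theorem Psu_inv : Psu⁻¹ = Psu := by
  rw [inv_eq_iff_mul_eq_one, Psu_mul_Psu]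

/-- The toron: `U(x, 0) = P`, all other links `1` (one-site torus, `L = 1`). -/
def toron : GaugeConfig 4 1 SU3 := fun e => if e.2 = 0 then Psu else 1

/-- The toron is flat: every based plaquette holonomy is `1`. -/
theorem plaquetteHolonomy_toron (y : TorusSite 4 1) (μ ν : Fin 4) :
    plaquetteHolonomy toron y μ ν = 1 := by
  unfold plaquetteHolonomy toron
  by_cases hμ : μ = 0 <;> by_cases hν : ν = 0 <;> simp [hμ, hν, Psu_inv, Psu_mul_Psu]


/-! ### The Wilson–Dirac operator on the one-site torus
(the free one, `wilsonDirac_freeCfg_one_zero : D_W(1) = 0` at `m = 0`, and the instance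
`Subsingleton (TorusSite 4 1)` are imported from the landed
`SmallFieldUltracontractivity/Negative/LoadBearing.lean`) -/

/-- Diagonal of the toron's Wilson–Dirac operator at `m = 0`: `2` on colours `0, 1`, `0` on colour `2`. -/
def torD : TorusSite 4 1 × Fin 3 × Fin 4 → ℂ := fun i => if i.2.1 = 2 then 0 else 2

/-- The toron's Wilson–Dirac operator on the one-site torus at `m = 0`, `r = 1` is
`diag(2, 2, 0)_colour ⊗ 1_spin`. -/
theorem wilsonDirac_toron :
    wilsonDirac (fundamentalRep (Fin 3)) toron 0 1 = Matrix.diagonal torD := by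
  ext ⟨x, a, α⟩ ⟨y, b, β⟩
  obtain rfl : x = y := Subsingleton.elim _ _
  fin_cases a <;> fin_cases b <;> by_cases hαβ : α = β <;>
    simp [wilsonDirac, toron, torD, Pmat, Psu_inv, hαβ, Fin.sum_univ_four, Matrix.one_apply,
      eq_iff_true_of_subsingleton] <;> ring


/-! ### Heat kernels on the one-site torus -/

/-- `NormedSpace.exp` on `ℂ` is `Complex.exp`. -/
theorem nexp_complex (z : ℂ) : NormedSpace.exp z = Complex.exp z :=
  (congr_fun Complex.exp_eq_exp_ℂ z).symm

/-- Free traced diagonal on the one-site torus at `m = 0`: `e^{0} = 1`, twelve diagonal ones. -/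
theorem trDiag_free_one (t : ℝ) (x : TorusSite 4 1) : trDiag (freeCfg 1) 0 t x = 12 := by
  simp only [trDiag,
    Summit.QuantumFields.QCD.Theorems.SmallFieldUltracontractivity.Negative.wilsonDirac_freeCfg_one_zero,
    Matrix.conjTranspose_zero, Matrix.zero_mul, smul_zero,
    NormedSpace.exp_zero, Matrix.one_apply_eq, Complex.one_re]
  norm_num

/-- The eigenvalues of the toron's `H = Dᴴ D`: `4` on colours `0, 1`, `0` on colour `2`. -/
def torH : TorusSite 4 1 × Fin 3 × Fin 4 → ℂ := fun i => if i.2.1 = 2 then 0 else 4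

/-- `D_W(toron)ᴴ D_W(toron) = diag(4,4,0)_colour ⊗ 1_spin` at `m = 0`. -/
theorem hsq_toron :
    (wilsonDirac (fundamentalRep (Fin 3)) toron 0 1)ᴴ * wilsonDirac (fundamentalRep (Fin 3)) toron 0 1 =
      Matrix.diagonal torH := by
  rw [wilsonDirac_toron, Matrix.diagonal_conjTranspose, Matrix.diagonal_mul_diagonal]
  congr 1
  funext i
  by_cases h : i.2.1 = 2
  · norm_num [torD, torH, h]
  · norm_num [torD, torH, h]

/-- The toron heat kernel `e^{-tH}` is the diagonal matrix `diag(e^{-t·torH})`. -/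
theorem heat_toron (t : ℝ) :
    NormedSpace.exp (-(t : ℂ) • ((wilsonDirac (fundamentalRep (Fin 3)) toron 0 1)ᴴ *
        wilsonDirac (fundamentalRep (Fin 3)) toron 0 1)) =
      Matrix.diagonal (fun i => Complex.exp (-(t : ℂ) * torH i)) := by
  rw [hsq_toron, ← Matrix.diagonal_smul, Matrix.exp_diagonal]
  congr 1
  funext i
  rw [Pi.coe_exp, nexp_complex]
  rfl

/-- Toron traced diagonal on the one-site torus at `m = 0`: `8 e^{−4t} + 4`. -/
theorem trDiag_toron (t : ℝ) (x : TorusSite 4 1) : trDiag toron 0 t x = 8 * Real.exp (-(4 * t)) + 4 := by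
  simp only [trDiag, heat_toron, Matrix.diagonal_apply_eq, torH]
  have h4 : (Complex.exp (-((t : ℂ) * 4))).re = Real.exp (-(4 * t)) := by
    rw [show (-((t : ℂ) * 4)) = ((-(4 * t) : ℝ) : ℂ) by push_cast; ring, Complex.exp_ofReal_re]
  simp only [Fin.sum_univ_three, Fin.isValue, Fin.reduceEq, if_false, if_true, neg_mul, mul_zero,
    neg_zero, Complex.exp_zero, Complex.one_re, Finset.sum_const, Finset.card_univ, Fintype.card_fin,
    nsmul_eq_mul, h4]
  push_cast
  ring


/-! ### `r ≤ L` is load-bearing -/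

/-- **Any proof of the crux must use `r ≤ L`.**  Without it, take the one-site torus `L = 1`, the
toron `U(·,0) = diag(−1,−1,1)` (all plaquettes trivial, so the smallness hypothesis holds for EVERY
`r`), `m = 0`, `t = r²`: the traced kernels are `8e^{−4t} + 4` (toron) and `12` (free), so the
left side is `8 − 8e^{−4r²} ≥ 4`, while the right side `C(ε/r²)² + C e^{−c/(r²(1+log r²)²)}/r⁴ ≤
|C|(ε² + 1)/r → 0`.  (Physically: for `t ≫ L²` the free kernel is carried by its zero mode `12/L⁴`
while a flat connection with non-trivial holonomy is gapped; in the crux `t ≤ r² ≤ L²` and the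
log-corrected tail `C e^{−cL²/(t(1+log t)²)}/t² → C/t²` at `t ≍ L²` absorb exactly this.) -/
theorem tracedQuadraticParametrix_false_without_rLeL : ¬ TracedQuadraticParametrixWithoutRLeL := by
  rintro ⟨ε, _hε, C, c, hc, h⟩
  -- a large radius `n`
  have hK0 : 0 ≤ |C| * ε ^ 2 + |C| := by positivity
  obtain ⟨n, hn⟩ := exists_nat_gt (|C| * ε ^ 2 + |C|)
  have hnpos : (0 : ℝ) < n := hK0.trans_lt hn
  have hn1 : 1 ≤ n := Nat.one_le_iff_ne_zero.mpr (by rintro rfl; simp at hnpos)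
  have hN : (1 : ℝ) ≤ n := by exact_mod_cast hn1
  have ht1 : (1 : ℝ) ≤ (n : ℝ) ^ 2 := by nlinarith
  have hn2 : (n : ℝ) ≤ (n : ℝ) ^ 2 := by nlinarith
  have hn4 : (n : ℝ) ≤ ((n : ℝ) ^ 2) ^ 2 := hn2.trans (by nlinarith)
  -- the instance of the (r ≤ L)-free statement at L = 1, toron, m = 0, r = n, t = n²
  have hm : (0 : ℝ) ∈ Set.Icc (-(1 / 2 : ℝ)) 1 := by constructor <;> norm_num
  have hP : SmallPlaq toron ((ε / (n : ℝ) ^ 2) ^ 2) := by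
    intro y μ ν
    simp only [plaquetteHolonomy_toron, map_one, Matrix.trace_one, Fintype.card_fin]
    norm_num
    positivity
  have key := h 1 toron 0 hm n hn1 hP ((n : ℝ) ^ 2) ht1 le_rfl (fun _ => 0)
  rw [trDiag_toron, trDiag_free_one] at key
  -- left side ≥ 4
  have hE : (2 : ℝ) ≤ Real.exp (4 * (n : ℝ) ^ 2) :=
    le_trans (by nlinarith) (Real.add_one_le_exp _)
  have he0 : 0 < Real.exp (-(4 * (n : ℝ) ^ 2)) := Real.exp_pos _
  have he1 : Real.exp (-(4 * (n : ℝ) ^ 2)) * Real.exp (4 * (n : ℝ) ^ 2) = 1 := by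
    rw [← Real.exp_add]; simp
  have he : Real.exp (-(4 * (n : ℝ) ^ 2)) ≤ 1 / 2 := by
    nlinarith [mul_le_mul_of_nonneg_left hE he0.le]
  have hX : (4 : ℝ) ≤ |8 * Real.exp (-(4 * (n : ℝ) ^ 2)) + 4 - 12| := by
    rw [abs_of_nonpos (by linarith)]
    linarith
  -- right side ≤ (|C| ε² + |C|)/n < 1
  have hT1 : C * (ε / (n : ℝ) ^ 2) ^ 2 ≤ |C| * ε ^ 2 / n :=
    calc C * (ε / (n : ℝ) ^ 2) ^ 2 ≤ |C| * (ε / (n : ℝ) ^ 2) ^ 2 :=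
          mul_le_mul_of_nonneg_right (le_abs_self C) (sq_nonneg _)
      _ = |C| * ε ^ 2 / ((n : ℝ) ^ 2) ^ 2 := by rw [div_pow]; ring
      _ ≤ |C| * ε ^ 2 / n := div_le_div_of_nonneg_left (by positivity) hnpos hn4
  have hA : Real.exp (-(c * ((1 : ℕ) : ℝ) ^ 2 / ((n : ℝ) ^ 2 * (1 + Real.log ((n : ℝ) ^ 2)) ^ 2))) ≤ 1 :=
    Real.exp_le_one_iff.mpr (neg_nonpos.mpr (by positivity))
  have hT2 : C * Real.exp (-(c * ((1 : ℕ) : ℝ) ^ 2 / ((n : ℝ) ^ 2 * (1 + Real.log ((n : ℝ) ^ 2)) ^ 2))) /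
      ((n : ℝ) ^ 2) ^ 2 ≤ |C| / n := by
    set e := Real.exp (-(c * ((1 : ℕ) : ℝ) ^ 2 / ((n : ℝ) ^ 2 * (1 + Real.log ((n : ℝ) ^ 2)) ^ 2)))
    have hepos : 0 ≤ e := Real.exp_nonneg _
    calc C * e / ((n : ℝ) ^ 2) ^ 2 ≤ |C| * e / ((n : ℝ) ^ 2) ^ 2 := by
          gcongr; exact le_abs_self C
      _ ≤ |C| * 1 / ((n : ℝ) ^ 2) ^ 2 := by gcongr
      _ = |C| / ((n : ℝ) ^ 2) ^ 2 := by ring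
      _ ≤ |C| / n := div_le_div_of_nonneg_left (abs_nonneg C) hnpos hn4
  have hsum : |C| * ε ^ 2 / n + |C| / n = (|C| * ε ^ 2 + |C|) / n := by ring
  have hlt : (|C| * ε ^ 2 + |C|) / (n : ℝ) < 1 := (div_lt_one hnpos).mpr hn
  have hrhs : rhs ε C c 1 n ((n : ℝ) ^ 2) ≤ |C| * ε ^ 2 / n + |C| / n := add_le_add hT1 hT2
  linarith

end Summit.QuantumFields.QCD.Theorems.TracedQuadraticParametrix.Negative
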